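/-
Copyright (c) 2026. All rights reserved.
Released under Apache 2.0 license as described in the file LICENSE.

[NoBLE17] = Fitzner–van der Hofstad, "Generalized approach to the non-backtracking lace expansion",
Probab. Theory Relat. Fields 169 (2017) 1041–1119 (arXiv:1506.07969).  Page numbers below are PTRF pages.
-/
import Literature.Probability.FitznerVanDerHofstad2017.NobleKSpaceRewriteFRem
import Literature.Probability.FitznerVanDerHofstad2017.NobleSimplifiedFormF3
import HarnessLib

/-!
# The extended simplified form `NobleSimplifiedFormF3At` from Assumptions 4.1–4.3: assembly, with (D.3) upper proved

`NobleKSpaceRewriteFRem.nobleSimplifiedFormAt_of_assumptions₅` constructs the six constants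
`c_Φ, α_Φ, R_Φ, c_F, α_F, R_F` of the simplified rewrite ([NoBLE17] §4.1.3) from Assumptions 4.1–4.3 and PROVES the
eight bounds of `NobleBeta` ((D.2) upper, (D.3) lower, (D.4), (D.5), (D.14), (D.32)).  The `f₃` analysis
(§3.3.4–3.3.5) needs the five further constants of Assumption 2.7 recorded by `NobleBetaF3`
(`NobleSimplifiedFormF3.lean`): `c̲_Φ` ((D.2) lower), `ᾱ_F` ((D.3) upper), `β_{R,F}` ((D.13)), `β_{ΔR,Φ}` ((D.21)),
`β_{|ΔR,F|}` ((D.29)), typed as `BetaMap.extraOfInputs d i`.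

This module
* PROVES (D.3) upper: `α_F ≤ ᾱ_F(i)` (`noble_alphaF_le_betaAfUp_mu` with the exact `μ_p`, and
  `noble_alphaF_upper` with `μ_p` replaced by its Assumption-4.3 bound `i.mu`, the replacement being monotone on
  the capped region `i.mu ≤ 7/10`, `i.piAlphaLower ≤ 1/8` of `BetaMap.betaAfUp_mono_fn` — outside it the printed
  substitution "we bound μ by Γ₁c_μ/(2d−1)" is not monotone in the subtracted `Π_α`-term);
* records that (D.2) lower `c̲_Φ(i) ≤ c_Φ` is the first half of `noble_cPhi_bounds`;
* assembles `NobleSimplifiedFormF3At d p (nobleBetaOfInputsCorr d i) (NobleBetaF3.ofFn (extraOfInputs d i))`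
  (`nobleSimplifiedFormF3At_of_assumptions₅`, percolation instance `nobleSimplifiedFormF3At_percolation₅`) from the
  hypotheses of `nobleSimplifiedFormAt_of_assumptions₅`, the two caps, and — as the three remaining NAMED ANALYTIC
  HYPOTHESES, stated verbatim as the displays of [NoBLE17] App. D on the constructed remainders `nobleFRem S`,
  `noblePhiRem S` — (D.13) `Σ_x |R_F(x)| ≤ β_{R,F}(i)`, (D.21) `Σ_x ‖x‖₂² |R_Φ(x)| ≤ β_{ΔR,Φ}(i)`,
  (D.29) `Σ_x ‖x‖₂² |R_F(x)| ≤ β_{|ΔR,F|}(i)` (each with the summability it asserts).  Discharging these three is the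
  remaining content of App. D Steps 2–4 for the extended form; nothing else of App. D is assumed.

No numeral other than the two caps of `betaAfUp_mono_fn` enters; no dimension is fixed.
-/

noncomputable section

namespace Literature.Probability.FitznerVanDerHofstad2017

open MeasureTheory Finset Filter
open scoped BigOperators
open Literature.Probability.LatticeModels
open Literature.Probability.Percolation
open Literature.Barriers.CriticalPhenomena
open Literature.Probability.RandomPlanarGeometry.SAW.Zd (normSq normSq_nonneg)

variable {d : ℕ}

/-! ## A. (D.3), upper half: `α_F ≤ ᾱ_F` -/

section D3up

local notation "𝐞" => Literature.Probability.Percolation.stepVec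

variable {p : unitInterval} {i : BetaMap.Inputs} {S : NobleSplit d p}

/-- **[NoBLE17] (D.3), upper half, with the exact `μ_p`:**
`α_F ≤ (2dμ_p/(1−μ_p²))·[1 + β^{(0−1)}_{ΣΨα,I} + μ_p β^{(1−0)}_{ΣΨα,II} − (1/(1−μ_p²)) β̲^{(0)}_{ΣΠα}]`.
From the closed form of `α_F` (`nobleAlphaF_eq`) and (4.40) upper, (4.41) lower, (4.42) lower of Assumption 4.3;
only `0 ≤ μ_p < 1` is used, no sign of the bracket.
[cite: FitznerVanDerHofstad2016NoBLE, App. D Step 1 c) (D.3) (p. 1111); Assumption 4.3 (4.40)–(4.42) (pp. 1086–1087); §4.1.3 (p. 1083)] -/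
theorem noble_alphaF_le_betaAfUp_mu (hd : 1 ≤ d) (hWF : NobleInputsWF d i) (h43 : NobleAssumption43At d p S i) :
    nobleAlphaF S ≤ BetaMap.betaAfUp d (nobleMu d p) i.psiAlphaIZeroMinusOneAroundEi
      i.psiAlphaIIOneMinusZeroAroundZero i.piAlphaLower := by
  unfold BetaMap.betaAfUp
  set μ := nobleMu d p with hμ
  set P1 := i.psiAlphaIZeroMinusOneAroundEi with hP1
  set P2 := i.psiAlphaIIOneMinusZeroAroundZero with hP2
  set P3 := i.piAlphaLower with hP3
  set AI := ∑ ι, ∑ κ, (S.psiAI 0 ι (𝐞 ι + 𝐞 κ) - S.psiAI 1 ι (𝐞 ι + 𝐞 κ)) with hAI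
  set AII := ∑ ι, ∑ κ, (S.psiAII 0 ι (𝐞 κ) - S.psiAII 1 ι (𝐞 κ)) with hAII
  set C := ∑ ι, ∑ κ, S.piA ι κ (𝐞 ι) with hC
  have hdpos : (0 : ℝ) < d := Nat.cast_pos.2 hd
  have hμ0 : 0 ≤ μ := nobleMu_nonneg d p
  have hμ1 : μ < 1 := lt_of_le_of_lt h43.mu_le hWF.1.mu_lt_one
  have hcμ : 0 < 1 - μ ^ 2 := by nlinarith
  have hc0 : 0 ≤ (1 - μ ^ 2)⁻¹ := inv_nonneg.2 hcμ.le
  -- the three Assumption-4.3 aggregates, in the directions needed for an upper bound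
  have hAI' : AI ≤ 2 * d * P1 := by
    have := Finset.sum_le_sum fun ι (_ : ι ∈ Finset.univ) => h43.psiAlphaIAroundEi_upper ι
    rw [sum_const_dir] at this
    exact this
  have hAII' : -(2 * d * P2) ≤ AII := by
    have := Finset.sum_le_sum fun ι (_ : ι ∈ Finset.univ) => h43.psiAlphaIIAroundZero_lower ι
    rw [sum_const_dir] at this
    linarith
  have hC' : 2 * d * P3 ≤ C := by
    have := Finset.sum_le_sum fun ι (_ : ι ∈ Finset.univ) => h43.piAlpha_lower ι
    rw [sum_const_dir] at this
    exact this
  have hαF : nobleAlphaF S = μ * (1 - μ ^ 2)⁻¹ * (2 * d + AI - μ * AII - (1 - μ ^ 2)⁻¹ * C) := by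
    rw [nobleAlphaF_eq]; ring
  rw [hαF]
  have hY : 2 * d + AI - μ * AII - (1 - μ ^ 2)⁻¹ * C ≤ 2 * d * (1 + P1 + μ * P2 - 1 / (1 - μ ^ 2) * P3) := by
    have h1 : -(μ * AII) ≤ μ * (2 * d * P2) := by
      have := mul_le_mul_of_nonneg_left hAII' hμ0
      linarith
    have h2 : (1 - μ ^ 2)⁻¹ * (2 * d * P3) ≤ (1 - μ ^ 2)⁻¹ * C := mul_le_mul_of_nonneg_left hC' hc0
    rw [one_div]
    nlinarith
  calc μ * (1 - μ ^ 2)⁻¹ * (2 * d + AI - μ * AII - (1 - μ ^ 2)⁻¹ * C)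
      ≤ μ * (1 - μ ^ 2)⁻¹ * (2 * d * (1 + P1 + μ * P2 - 1 / (1 - μ ^ 2) * P3)) :=
        mul_le_mul_of_nonneg_left hY (mul_nonneg hμ0 hc0)
    _ = 2 * d * μ / (1 - μ ^ 2) * (1 + P1 + μ * P2 - 1 / (1 - μ ^ 2) * P3) := by
        rw [div_eq_mul_inv]; ring

/-- **[NoBLE17] (D.3), upper half: `α_F ≤ ᾱ_F(i)`** (`= BetaMap.extraOfInputs d i 1`, the printed bound with `μ_p`
replaced by its Assumption-4.3 bound `i.mu`: "In this and the following lines we bound μ by Γ₁c_μ/(2d−1)").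
The replacement is monotone on the capped region `i.mu ≤ 7/10`, `i.piAlphaLower ≤ 1/8`
(`BetaMap.betaAfUp_mono_fn`); both caps hold with large room at every state of the mean-field computations.
[cite: FitznerVanDerHofstad2016NoBLE, App. D Step 1 c) (D.3) (p. 1111); Assumption 4.3 (4.40)–(4.42) (pp. 1086–1087)] -/
theorem noble_alphaF_upper (hd : 1 ≤ d) (hWF : NobleInputsWF d i) (h43 : NobleAssumption43At d p S i)
    (hcap : i.mu ≤ 7 / 10) (hP : i.piAlphaLower ≤ 1 / 8) :
    nobleAlphaF S ≤ BetaMap.extraOfInputs d i 1 := by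
  have h := noble_alphaF_le_betaAfUp_mu hd hWF h43
  have hmono := BetaMap.betaAfUp_mono_fn (d := (d : ℝ)) (Nat.cast_pos.2 hd) (nobleMu_nonneg d p) h43.mu_le hcap
    (le_refl i.psiAlphaIZeroMinusOneAroundEi) (le_refl i.psiAlphaIIOneMinusZeroAroundZero) (le_refl i.piAlphaLower)
    hWF.1.psiAlphaIZeroMinusOneAroundEi hWF.1.psiAlphaIIOneMinusZeroAroundZero hP
  have h1 : BetaMap.extraOfInputs d i 1 = BetaMap.betaAfUp d i.mu i.psiAlphaIZeroMinusOneAroundEi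
      i.psiAlphaIIOneMinusZeroAroundZero i.piAlphaLower := by
    simp [BetaMap.extraOfInputs]
  rw [h1]
  exact h.trans hmono

/-- (D.2), lower half, recorded under its Assumption-2.7 name: `c̲_Φ(i) = extraOfInputs d i 0 ≤ c_Φ`
(`noble_cPhi_bounds`). [cite: FitznerVanDerHofstad2016NoBLE, App. D Step 1 b) (D.2) (p. 1111)] -/
theorem noble_cPhi_lower (hWF : NobleInputsWF d i) (h43 : NobleAssumption43At d p S i) :
    BetaMap.extraOfInputs d i 0 ≤ noblePhiAlpha S 0 := by
  have h0 : BetaMap.extraOfInputs d i 0 =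
      BetaMap.betaCPhiLow d i.mu i.xiAlphaOneMinusZeroAtZero i.xiIotaAlphaIAtEi := by
    simp [BetaMap.extraOfInputs]
  rw [h0]
  exact (noble_cPhi_bounds hWF h43).1

end D3up

/-! ## B. The extended form from candidate constants and their bounds -/

section Bounds

variable {p : unitInterval} {P X : ℝ}

variable [NeZero d]

/-- **Assembly of the EXTENDED simplified form from explicit bounds** (the `NobleBetaF3` analogue of
`nobleSimplifiedFormAt_of_bounds`): given the `ℓ¹` hypotheses `NobleL1At`, the equation `(E)`, the Lemma-3.1 data,
candidate constants `c_Φ, α_Φ, c_F, α_F` with the eight `NobleBeta` bounds AND the five `NobleBetaF3` bounds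
(`c̲_Φ ≤ c_Φ`, `α_F ≤ ᾱ_F`, `Σ|R_F| ≤ β_{R,F}`, `Σ‖x‖₂²|R_Φ| ≤ β_{ΔR,Φ}`, `Σ‖x‖₂²|R_F| ≤ β_{|ΔR,F|}` with their
summabilities) for the remainders `R_Φ := Φ − c_Φδ − α_Φ D`, `R_F := F − c_Fδ − α_F D` (`nobleRem`), the extended
form `NobleSimplifiedFormF3At d p B E` holds.
[cite: FitznerVanDerHofstad2016NoBLE, §1.3 (1.8) (p. 1045); Prop. 4.5(ii) (p. 1088); Lemma 3.1 (pp. 1065–1066); Assumption 2.7 (a)–(c) (pp. 1059–1060)] -/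
theorem nobleSimplifiedFormF3At_of_bounds (h : NobleL1At d p P X) (hE : PercolationNobleEquationAt d p)
    (hμ0 : 0 < nobleMu d p) {ψ π ξι : ℝ}
    (hψ : ∀ ι, ∑' x, noblePsi d p ι x = ψ) (hπrow : ∀ ι, ∑ κ, ∑' x, noblePi d p ι κ x = π)
    (hπcol : ∀ κ, ∑ ι, ∑' x, noblePi d p ι κ x = π) (hξι : ∀ ι, ∑' x, nobleXiIota d p ι x = ξι)
    (hψ1 : -1 < ψ) (hsmall : (∑' x, |nobleXi d p x|) + X < 1)
    (B : NobleBeta) (E : NobleBetaF3) {cΦ αΦ cF αF : ℝ}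
    (hβμ : (p : ℝ) ≤ B.βμ * nobleMu d p) (hcΦ0 : 0 ≤ cΦ) (hcΦ : cΦ ≤ B.cΦup) (hαΦ : |αΦ| ≤ B.βαΦ)
    (hαF : B.αFlow ≤ αF) (hπB : π ≤ B.βPi) (hψB : -B.βΨ ≤ ψ)
    (hRΦ : ∑' x, |nobleRem (noblePhi d p) cΦ αΦ x| ≤ B.βRΦ)
    (hΔ : ∀ k ∈ cube d, -(B.βΔ * (1 - Dhat d k)) ≤
      cosFT (nobleRem (nobleF d p) cF αF) 0 - cosFT (nobleRem (nobleF d p) cF αF) k)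
    (hcΦlow : E.cΦlow ≤ cΦ) (hαFup : αF ≤ E.αFup)
    (hRF : ∑' x, |nobleRem (nobleF d p) cF αF x| ≤ E.βRF)
    (hsΦ : Summable fun x => normSq x * |nobleRem (noblePhi d p) cΦ αΦ x|)
    (hΔΦ : ∑' x, normSq x * |nobleRem (noblePhi d p) cΦ αΦ x| ≤ E.βΔRΦ)
    (hsF : Summable fun x => normSq x * |nobleRem (nobleF d p) cF αF x|)
    (hΔF : ∑' x, normSq x * |nobleRem (nobleF d p) cF αF x| ≤ E.βΔRFabs) :
    NobleSimplifiedFormF3At d p B E := by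
  obtain ⟨hlam0, hlamlt, hμeq, hFeq, -, -, -⟩ := noble_lemma31 h hE hμ0 hψ hπrow hπcol hξι hψ1 hsmall
  refine ⟨cΦ, αΦ, cF, αF, ψ, π, nobleLam d p ψ π, nobleRem (noblePhi d p) cΦ αΦ, nobleRem (nobleF d p) cF αF,
    (summable_abs_nobleRem (summable_abs_noblePhi h) _ _).of_abs,
    (summable_abs_nobleRem (summable_abs_nobleF h) _ _).of_abs,
    ?_, hμeq, ?_, hlam0, hlamlt, hβμ, hcΦ0, hcΦ, hαΦ, hαF, hπB, hψB, hRΦ, hΔ, hcΦlow, hαFup, hRF, hsΦ, hΔΦ,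
    hsF, hΔF⟩
  · intro k _
    rw [cosFT_nobleRem (summable_abs_nobleF h), cosFT_nobleRem (summable_abs_noblePhi h),
      ← noble_real_identity h hE k]
    ring
  · rw [cosFT_nobleRem (summable_abs_nobleF h), Dhat_zero, cosFT_zero, hFeq]
    ring

end Bounds

/-! ## C. The extended form from Assumptions 4.1–4.3, with (D.13), (D.21), (D.29) as named hypotheses -/

section Assembly5F3

local notation "𝐞" => Literature.Probability.Percolation.stepVec

variable {p : unitInterval} {i : BetaMap.Inputs} {S : NobleSplit d p}

variable (hd : 2 ≤ d) (hp : p < criticalProbI d)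
include hd hp

/-- **[NoBLE17, Prop. 4.5(ii) / App. D — extended form, theorem with three named analytic hypotheses].**
Under the hypotheses of `nobleSimplifiedFormAt_of_assumptions₅` (NoBLE equation at `p`, Assumption 4.1 for the
split `S`, Assumption 4.3 with well-formed constants `i`, the three shifted-`α` TRS facts, the sign conditions
(N1') `0 ≤ c̲_Φ(i)`, (N2), (N3), (N4) `0 ≤ α̲_F(i)`), the caps `i.mu ≤ 7/10`, `i.piAlphaLower ≤ 1/8` of (D.3) upper,
and — AS HYPOTHESES, verbatim the displays of App. D for the constructed remainders `R_F = nobleFRem S`,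
`R_Φ = noblePhiRem S` — (D.13) `Σ_x |R_F(x)| ≤ β_{R,F}(i)`, (D.21) `Σ_x ‖x‖₂² |R_Φ(x)| ≤ β_{ΔR,Φ}(i)`,
(D.29) `Σ_x ‖x‖₂² |R_F(x)| ≤ β_{|ΔR,F|}(i)` (with summability): the EXTENDED simplified form
`NobleSimplifiedFormF3At d p (nobleBetaOfInputsCorr d i) (NobleBetaF3.ofFn (extraOfInputs d i))` holds.
The `NobleBeta` part and (D.2) lower, (D.3) upper are PROVED; (D.13), (D.21), (D.29) are the named inputs.
[cite: FitznerVanDerHofstad2016NoBLE, Prop. 4.5 (p. 1088); App. D (D.2), (D.3) (p. 1111), (D.13) (p. 1113), (D.21) (p. 1115), (D.29) (p. 1116), (D.32) (p. 1118); Assumption 2.7 (pp. 1059–1060)] -/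
theorem nobleSimplifiedFormF3At_of_assumptions₅ (hp0 : 0 < (p : ℝ)) (hWF : NobleInputsWF d i)
    (hE : PercolationNobleEquationAt d p) (h41 : NobleAssumption41At d p S) (h43 : NobleAssumption43At d p S i)
    (hTRS : IsTRS (fun x => ∑ ι, S.xiIotaAI ι (x + 𝐞 ι)))
    (hI : ∀ N ≤ 1, IsTRS (fun x => ∑ ι, S.psiAI N ι (x + 𝐞 ι)))
    (hPi : IsTRS (fun x => ∑ ι, ∑ κ, S.piA ι κ (x + 𝐞 ι + 𝐞 κ)))
    (hN1 : 0 ≤ BetaMap.betaCPhiLow d i.mu i.xiAlphaOneMinusZeroAtZero i.xiIotaAlphaIAtEi)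
    (hN2 : i.xiAbs + i.xiIotaAbs < 1) (hN3 : (BetaMap.nobleBetaOfInputs d i).βΨ < 1)
    (hN4 : 0 ≤ (BetaMap.nobleBetaOfInputs d i).αFlow)
    (hcap : i.mu ≤ 7 / 10) (hcapP : i.piAlphaLower ≤ 1 / 8)
    (hD13 : ∑' x, |nobleFRem S x| ≤ BetaMap.extraOfInputs d i 2)
    (hD21 : (Summable fun x => normSq x * |noblePhiRem S x|) ∧
      ∑' x, normSq x * |noblePhiRem S x| ≤ BetaMap.extraOfInputs d i 3)
    (hD29 : (Summable fun x => normSq x * |nobleFRem S x|) ∧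
      ∑' x, normSq x * |nobleFRem S x| ≤ BetaMap.extraOfInputs d i 4) :
    NobleSimplifiedFormF3At d p (BetaMap.nobleBetaOfInputsCorr d i)
      (NobleBetaF3.ofFn (BetaMap.extraOfInputs d i)) := by
  haveI : NeZero d := ⟨by omega⟩
  have hp1 : (p : ℝ) < 1 :=
    lt_of_lt_of_le (show (p : ℝ) < (criticalProbI d : ℝ) by exact_mod_cast hp) (criticalProbI d).2.2
  have hμ0 : 0 < nobleMu d p := nobleMu_pos (by omega) hp0 hp1
  have h := nobleL1At_of_assumption43 hd hp hp0 h43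
  -- Lemma 3.1 inputs (module 1)
  set η : Fin d × Bool := (⟨0, by omega⟩, true) with hη
  obtain ⟨hrow, hcol⟩ := noble_pi_rowcol hd hp h41 h43 η
  have hψ : ∀ ι, ∑' x, noblePsi d p ι x = ∑' x, noblePsi d p η x := fun ι => noble_tsum_psi_eq hd hp h41 h43 ι η
  have hξι : ∀ ι, ∑' x, nobleXiIota d p ι x = ∑' x, nobleXiIota d p η x :=
    fun ι => noble_tsum_xiIota_eq h41 h43 ι η
  have hψB := noble_psi_lower hd hp hp0 h41 h43 η
  have hπB := noble_pi_upper hd hp hp0 h43 η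
  have hψ1 : -1 < ∑' x, noblePsi d p η x := by linarith
  have hΞ : (∑' x, |nobleXi d p x|) ≤ i.xiAbs :=
    (alternating_of_NSumLE (fun N x => nobleXiN_nonneg p N x) h43.xiAbs).2.1
  have hsmall : (∑' x, |nobleXi d p x|) + i.xiIotaAbs < 1 := by linarith
  have hβμ : (p : ℝ) ≤ (BetaMap.nobleBetaOfInputsCorr d i).βμ * nobleMu d p := h43.mubOverMu
  -- App. D Steps 1–2 (modules 2, 3b)
  have hΞs : ∀ x, Summable fun N => nobleXiN d p N x :=
    (l1_of_NSumLE (fun N x => nobleXiN_nonneg p N x) h43.xiAbs).1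
  have hΞι : ∀ ι x, Summable fun N => nobleXiIotaN d p (𝐞 ι) N x := fun ι =>
    (l1_of_NSumLE (fun N x => nobleXiIotaN_nonneg p (𝐞 ι) N x) (h43.xiIotaAbs ι)).1
  have hrem : ∀ x, nobleRem (noblePhi d p) (noblePhiAlpha S 0) (2 * d * noblePhiAlpha S (𝐞 η)) x =
      noblePhiRem S x := nobleRem_noblePhi_eq h h41 hTRS hΞs hΞι η
  obtain ⟨hcL, hcU⟩ := noble_cPhi_bounds hWF h43
  have hαΦ := noble_alphaPhi_bound hWF h41 h43 hTRS η
  have hRΦ : ∑' x, |nobleRem (noblePhi d p) (noblePhiAlpha S 0) (2 * d * noblePhiAlpha S (𝐞 η)) x| ≤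
      (BetaMap.nobleBetaOfInputsCorr d i).βRΦ := by
    rw [tsum_congr fun x => congrArg abs (hrem x)]
    exact (noblePhiRem_l1 hd hp hp0 h43).2.trans (noblePhiRemBound_le hd hWF h43)
  have hαF : (BetaMap.nobleBetaOfInputsCorr d i).αFlow ≤ nobleAlphaF S := noble_alphaF_lower (by omega) hWF h43 hN4
  -- the NobleBetaF3 bounds: (D.2) lower, (D.3) upper proved; (D.13), (D.21), (D.29) from the hypotheses
  have hcΦlow : (NobleBetaF3.ofFn (BetaMap.extraOfInputs (d : ℝ) i)).cΦlow ≤ noblePhiAlpha S 0 := by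
    rw [NobleBetaF3.ofFn_cΦlow]
    exact noble_cPhi_lower hWF h43
  have hαFup : nobleAlphaF S ≤ (NobleBetaF3.ofFn (BetaMap.extraOfInputs (d : ℝ) i)).αFup := by
    rw [NobleBetaF3.ofFn_αFup]
    exact noble_alphaF_upper (by omega) hWF h43 hcap hcapP
  have hRF : ∑' x, |nobleRem (nobleF d p) (nobleCF S) (nobleAlphaF S) x| ≤
      (NobleBetaF3.ofFn (BetaMap.extraOfInputs (d : ℝ) i)).βRF := by
    rw [NobleBetaF3.ofFn_βRF]
    exact hD13
  have hsΦ : Summable fun x =>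
      normSq x * |nobleRem (noblePhi d p) (noblePhiAlpha S 0) (2 * d * noblePhiAlpha S (𝐞 η)) x| :=
    hD21.1.congr fun x => by rw [hrem x]
  have hΔΦ : ∑' x, normSq x * |nobleRem (noblePhi d p) (noblePhiAlpha S 0) (2 * d * noblePhiAlpha S (𝐞 η)) x| ≤
      (NobleBetaF3.ofFn (BetaMap.extraOfInputs (d : ℝ) i)).βΔRΦ := by
    rw [NobleBetaF3.ofFn_βΔRΦ, tsum_congr fun x => by rw [hrem x]]
    exact hD21.2
  have hsF : Summable fun x => normSq x * |nobleRem (nobleF d p) (nobleCF S) (nobleAlphaF S) x| := hD29.1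
  have hΔF : ∑' x, normSq x * |nobleRem (nobleF d p) (nobleCF S) (nobleAlphaF S) x| ≤
      (NobleBetaF3.ofFn (BetaMap.extraOfInputs (d : ℝ) i)).βΔRFabs := by
    rw [NobleBetaF3.ofFn_βΔRFabs]
    exact hD29.2
  -- App. D Steps 3–5 (modules 3a, 3b, 3c): the majorant of `(R_F)₋` and Lemma 2.12
  have hsc := nobleScalarFacts_of hd hp hp0 hWF h43
  have ht1 : nobleMajT d i < 1 := hWF.1.tmp2_lt_one
  obtain ⟨hm, hm0, hmw, hβ⟩ := nobleMaj_data hsc h43 ht1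
  have hT : IsTRS (nobleFAlpha S) := isTRS_nobleFAlpha h41 hI hPi
  have hΔ : ∀ k ∈ cube d, -((BetaMap.nobleBetaOfInputsCorr d i).βΔ * (1 - Dhat d k)) ≤
      cosFT (nobleRem (nobleF d p) (nobleCF S) (nobleAlphaF S)) 0 -
        cosFT (nobleRem (nobleF d p) (nobleCF S) (nobleAlphaF S)) k := fun k _ =>
    nobleFRem_lower_of_majorant h hm hm0 hmw (isTRS_nobleMaj h41 hI hPi)
      (neg_nobleMaj_le_nobleFRem hd hp hsc h43 h hT ht1) hβ k
  exact nobleSimplifiedFormF3At_of_bounds h hE hμ0 hψ hrow hcol hξι hψ1 hsmall _ _ hβμ (hN1.trans hcL) hcU hαΦ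
    hαF hπB hψB hRΦ hΔ hcΦlow hαFup hRF hsΦ hΔΦ hsF hΔF

/-- **Percolation instance** (`S := percolationNobleSplit d p`): Assumption 4.1 and the three shifted-`α` TRS
statements are theorems; what remains are the NoBLE equation, Assumption 4.3 with constants `i`, the decidable
sign conditions and caps, and the three named analytic hypotheses (D.13), (D.21), (D.29).
[cite: FitznerVanDerHofstad2016NoBLE, Prop. 4.5 (p. 1088), App. D (pp. 1110–1117); FitznerVanDerHofstad2017, §3.5] -/
theorem nobleSimplifiedFormF3At_percolation₅ (hp0 : 0 < (p : ℝ)) (hWF : NobleInputsWF d i)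
    (hE : PercolationNobleEquationAt d p) (h43 : NobleAssumption43At d p (percolationNobleSplit d p hd hp) i)
    (hN1 : 0 ≤ BetaMap.betaCPhiLow d i.mu i.xiAlphaOneMinusZeroAtZero i.xiIotaAlphaIAtEi)
    (hN2 : i.xiAbs + i.xiIotaAbs < 1) (hN3 : (BetaMap.nobleBetaOfInputs d i).βΨ < 1)
    (hN4 : 0 ≤ (BetaMap.nobleBetaOfInputs d i).αFlow)
    (hcap : i.mu ≤ 7 / 10) (hcapP : i.piAlphaLower ≤ 1 / 8)
    (hD13 : ∑' x, |nobleFRem (percolationNobleSplit d p hd hp) x| ≤ BetaMap.extraOfInputs d i 2)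
    (hD21 : (Summable fun x => normSq x * |noblePhiRem (percolationNobleSplit d p hd hp) x|) ∧
      ∑' x, normSq x * |noblePhiRem (percolationNobleSplit d p hd hp) x| ≤ BetaMap.extraOfInputs d i 3)
    (hD29 : (Summable fun x => normSq x * |nobleFRem (percolationNobleSplit d p hd hp) x|) ∧
      ∑' x, normSq x * |nobleFRem (percolationNobleSplit d p hd hp) x| ≤ BetaMap.extraOfInputs d i 4) :
    NobleSimplifiedFormF3At d p (BetaMap.nobleBetaOfInputsCorr d i)
      (NobleBetaF3.ofFn (BetaMap.extraOfInputs d i)) :=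
  nobleSimplifiedFormF3At_of_assumptions₅ hd hp hp0 hWF hE (nobleAssumption41At_percolation hd p hp) h43
    (percolationNobleSplit_xiIotaAI_shift_trs hd hp) (fun N _ => percolationNobleSplit_psiAI_shift_trs hd hp N)
    (percolationNobleSplit_piA_shift_trs hd hp) hN1 hN2 hN3 hN4 hcap hcapP hD13 hD21 hD29

end Assembly5F3

end Literature.Probability.FitznerVanDerHofstad2017
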